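import Summits.ResolutionOfSingularities.ResolutionOfSingularities.Theorems.MarkedTransferCampaignW46MohWindowShadeFormalInsepAnchor
import Summits.ResolutionOfSingularities.ResolutionOfSingularities.Theorems.MarkedTransferCampaignW46MohWindowShadeFormalInsepStep
import Summits.ResolutionOfSingularities.ResolutionOfSingularities.Theorems.MarkedTransferCampaignW46MohWindowShadeFormalPersistence
import HarnessLib

/-!
# [OURS · L1 W4.6 rung (iii)] The formally purely inseparable surface window PROPAGATES along the blow-ups of the procedure (algebraically closed field)

Cell `res-hironaka`, LADDER-RESOLUTION rung L (D-0089), slot W4.6 rung (iii); seat res-L1-s46-pv-6 (gen 6). Host route MarkedTransfer,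
`--supports stmt-ResolutionOfSingularities-16155 --as helper`; kind proof (no definition). Series twin of gen 5's `…FormalPersistence` (p532302):
if a stage lies in `Regime.mohWindowSurfaceFormalInsep` (`…FormalInsepStatement`, p543815) and the next stage of a §2.1-permissible step lies in
o1's regime of record, then the next stage lies in `Regime.mohWindowSurfaceFormalInsep` — over the centre the series anchor takes the SERIES STEP
(`exists_formalInsepAnchor_step`, brick 2c; the point upstairs is rational by Zariski's lemma), off the centre it is transported verbatim
(`exists_formalAnchor_offCentre`). Since the typed predicate demands NO normal form of `F`, no window or cleanedness has to be re-established.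
Consequence: the STAGE-0 form — a run inside o1's regime whose initial stage is formally purely inseparable stays so. OURS; NOT a statement of
the manuscript [claim: Hironaka2017, status: under-review], nothing of which is used. AI review is weaker than expert review.
References: H. Hauser, Bull. AMS 47 (2010) §F; Stacks Project Tag 0CY7. [Hauser2010] [StacksProject] [folklore]
-/

noncomputable section

set_option linter.dupNamespace false -- mandated namespace of this single-conjunct summit

open CategoryTheory AlgebraicGeometry TopologicalSpace IsLocalRing MvPolynomial

namespace Summit.ResolutionOfSingularities.ResolutionOfSingularities.Theorems

namespace CampaignW46

namespace MohWindowShadeFormalInsep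

open CategoryTheory AlgebraicGeometry TopologicalSpace
open Literature.AlgebraicGeometry.Resolution
open Literature.AlgebraicGeometry.Resolution.PointBlowup
open Literature.AlgebraicGeometry.Resolution.Hauser2010
open Literature.AlgebraicGeometry.Hironaka2017.S02Preliminaries
open Literature.AlgebraicGeometry.Hironaka2017.Datum
open Scheme.IdealSheafData
open MohWindowShadePS
open MohWindowShadeFormalStep (exists_formalAnchor_offCentre)

variable {p : ℕ} [Fact p.Prime] {K : Type} [Field K] [CharP K p]

/-- **PERSISTENCE of the formally purely inseparable window.** [OURS · L1 W4.6 rung (iii)] NOT a statement of the manuscript. Over an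
algebraically closed field: if `(Z, E)` lies in `Regime.mohWindowSurfaceFormalInsep`, `π : Z′ → Z` is a blow-up of the ambient datum at a permissible
centre and the transform lies in o1's regime `regimeMohWindowSurfaceInsep`, then the transform lies in `Regime.mohWindowSurfaceFormalInsep`.
[cite: Hauser2010, §F (chart expressions of a point blowup)] [cite: StacksProject, Tag 0CY7] -/
theorem mohWindowSurfaceFormalInsep_transform [IsAlgClosed K] {A A' : AmbientDatum p K} {E : IdealExponent A.Z} {D : Closeds A.Z}
    (π : A'.Z ⟶ A.Z) (hπ : IsBlowup π (vanishingIdeal D)) (hhom : A'.hom = π ≫ A.hom) (hD : E.IsPermissibleCentre A.hom D)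
    (hRg : Regime.mohWindowSurfaceFormalInsep (p := p) (K := K) A E)
    (hRg' : regimeMohWindowSurfaceInsep (p := p) (K := K) A' (E.transform π D)) :
    Regime.mohWindowSurfaceFormalInsep (p := p) (K := K) A' (E.transform π D) := by
  classical
  haveI : IsLocallyNoetherian A'.Z := ambient_isLocallyNoetherian A'
  refine ⟨hRg', fun ξ' hξ' => ?_⟩
  obtain ⟨hRgI, hformal⟩ := hRg
  obtain ⟨ξ₀, hξ₀S, hξ₀cl, hDξ₀⟩ :=
    IsPermissibleCentre.exists_eq_singleton_of_isolatedSing hD ((regimeMohWindowSurfaceInsep_iff _ _).mp hRgI).1.1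
  obtain ⟨hR', h3', hcl', -, hb'⟩ := MohWindowShadeAnchorWalk.regime_point hRg' hξ'
  haveI := hR'
  have hb : E.b = p := ((regimeMohWindowSurfaceInsep_iff _ _).mp hRgI).2
  -- the anchor downstairs, at `π ξ'` (a singular point of `E`)
  have hmem : π.base ξ' ∈ E.sing := sing_subset_of_transform hπ E hD.subset_sing hξ'
  obtain ⟨hR, h3, -, -, -⟩ := MohWindowShadeAnchorWalk.regime_point hRgI hmem
  haveI := hR
  obtain ⟨e, f₀, w, F, hJ, hw, hE⟩ := hformal (π.base ξ') hmem
  by_cases hover : π.base ξ' = ξ₀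
  · -- over the centre: the series model takes a step (the point upstairs is rational over the centre)
    have hDπ : (D : Set A.Z) = {π.base ξ'} := by rw [hDξ₀, hover]
    have hwin := window_of_formalInsepAnchor hRgI hmem e hJ hw F hE
    obtain ⟨o, ho, -⟩ := MohWindowShadePS.Series.exists_order_eq_of_lt (⟨F, 0⟩ : Series (Fin 2) K) hwin.2
    have hpo : p ≤ o := by have h := hwin.1; rw [show F = (⟨F, 0⟩ : Series (Fin 2) K).F from rfl, ho] at h; exact_mod_cast h
    haveI : LocallyOfFiniteType (π ≫ A.hom) := by
      rw [← hhom]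
      haveI := A'.smooth
      infer_instance
    have hrat : ∀ y : A'.Z.presheaf.stalk ξ', ∃ r : A.Z.presheaf.stalk (π.base ξ'),
        y - (π.stalkMap ξ').hom r ∈ maximalIdeal (A'.Z.presheaf.stalk ξ') := fun y =>
      CampaignW46.ChartPoint.exists_sub_stalkMap_mem_maximalIdeal_of_isClosed π A.hom ξ' hcl' y
    obtain ⟨c, b, e', f', w', -, -, -, hJ', hw', hE'⟩ :=
      exists_formalInsepAnchor_step π D hπ hb hDπ hmem hξ' h3 hrat e hJ hw ⟨F, 0⟩ ho hpo hE
    exact ⟨e', f', w', _, hJ', hw', hE'⟩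
  · -- off the centre: transport
    have hoff : π.base ξ' ∉ (D : Set A.Z) := by rw [hDξ₀, Set.mem_singleton_iff]; exact hover
    obtain ⟨e', f', hJ', hE'⟩ := exists_formalAnchor_offCentre (E := E) π hπ hoff e hJ _ hE
    exact ⟨e', f', w, F, hJ', hw, hE'⟩

/-- **A run inside o1's regime of record whose initial stage is formally purely inseparable stays formally purely inseparable** (algebraically
closed field) — hence this seat's rung applies to it: STAGE-0 FORM. [OURS · L1 W4.6 rung (iii)] NOT a statement of the manuscript. [folklore] -/
theorem permissibleRun_mohWindowSurfaceFormalInsep_of_start [IsAlgClosed K] (r : PermissibleRun p K)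
    (hr : ∀ k, regimeMohWindowSurfaceInsep (p := p) (K := K) (r.A k) (r.E k))
    (h0 : Regime.mohWindowSurfaceFormalInsep (p := p) (K := K) (r.A 0) (r.E 0)) (k : ℕ) :
    Regime.mohWindowSurfaceFormalInsep (p := p) (K := K) (r.A k) (r.E k) := by
  induction k with
  | zero => exact h0
  | succ k ih =>
    have h := mohWindowSurfaceFormalInsep_transform (r.π k) (r.blowup k) (r.hom_eq k) (r.permissible k) ih
      (by rw [← r.E_succ k]; exact hr (k + 1))
    rw [r.E_succ k]
    exact h

end MohWindowShadeFormalInsep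

end CampaignW46

end Summit.ResolutionOfSingularities.ResolutionOfSingularities.Theorems

end
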